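import Summits.Ventures.PercRepro.Night2LocalRuleHybridDefs

/-!
# PercRepro — the HYBRID rule: rows, columns, the certificate (night-2, gen 24)

With the definitions of `Night2LocalRuleHybridDefs` (`dload`, `cap3`, `pi2MassH`, `lossIncomeH`, `shareH`, `w2H`,
`w2D`, `wHybrid`): rows are exact (every member receives its demand: the `P`-members through the distance-one
shares `dsh`, the others through the fair-share layer with the capacities `cap3`), columns are at most `1`
(`w0 + w1 + dload + cap3 = w0 + w1 + cap2 ≤ 1`), hence

* **`localShadowHall_of_hybrid`**: with `|E ∖ G| ≤ q`, if `dsh` is nonnegative, supported on the supersets of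
  `B ∪ {z}`, sums (over the shadow sets) to the loss on every `P`-pair, loads no target beyond `cap2`
  (`dload S ≤ cap2 S`), and every non-`P` loss satisfies `loss B z ≤ rhoL B z · lossIncomeH B z`, then (LI_G) holds.
  With `P := fun _ => False` this is `localShadowHall_of_lossFair` (`Night2LocalRuleDistanceOne`).
-/

namespace PercRepro.Shadow

open Finset PerFlat ThmH

variable {α : Type*} [DecidableEq α] {M : Matroid α} [M.Finite]

section HybridRows

variable {q : ℕ} {G : Finset α} {P : Finset α → Prop} [DecidablePred P] {dsh : Finset α → α → Finset α → ℚ}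

/-! ## Rows -/

open scoped Classical in
/-- The shares of one non-`P` loss sum to the loss (under the per-loss condition). -/
theorem sum_shareH (hG : G ∈ flatsQ M (q + 1)) (hd : (gr M \ G).card ≤ q)
    (hdl : ∀ S ∈ shadowAt M (q + 2) q (Uq M (q + 2) q) G, dload M q G P dsh S ≤ cap2 M q G S)
    {B : Finset α} {z : α} (hcond : loss M q G B z ≤ rhoL M q G B z * lossIncomeH M q G P dsh B z) :
    ∑ S ∈ tgtSets M q G B z, shareH M q G P dsh B z S = loss M q G B z := by
  unfold shareH
  by_cases hl : loss M q G B z = 0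
  · simp [hl]
  · have hN : lossIncomeH M q G P dsh B z ≠ 0 := (lossIncomeH_pos hG hd hdl hl hcond).2.ne'
    simp only [hl, if_false]
    have hterm : ∀ S ∈ tgtSets M q G B z,
        loss M q G B z * (cap3 M q G P dsh S / pi2MassH M q G P S) / lossIncomeH M q G P dsh B z =
        (loss M q G B z / lossIncomeH M q G P dsh B z) * (cap3 M q G P dsh S / pi2MassH M q G P S) := by
      intro S _; ring
    rw [Finset.sum_congr rfl hterm, ← Finset.mul_sum]
    unfold lossIncomeH at hN ⊢
    field_simp

open scoped Classical in
/-- The row sum of the fair-share layer for a non-`P` thin member is its total loss. -/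
theorem sum_w2H_row (hG : G ∈ flatsQ M (q + 1)) (hd : (gr M \ G).card ≤ q)
    (hdl : ∀ S ∈ shadowAt M (q + 2) q (Uq M (q + 2) q) G, dload M q G P dsh S ≤ cap2 M q G S)
    {B : Finset α} (hB : B ∈ thinMembers M q G) (hP : ¬ P B)
    (hcond : ∀ z ∈ G \ clF M B, loss M q G B z ≤ rhoL M q G B z * lossIncomeH M q G P dsh B z) :
    ∑ S ∈ shadowAt M (q + 2) q (Uq M (q + 2) q) G, w2H M q G P dsh B S =
      ∑ z ∈ G \ clF M B, loss M q G B z := by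
  unfold w2H
  simp only [hB, hP, not_false_eq_true, and_self, if_true]
  rw [Finset.sum_comm]
  apply Finset.sum_congr rfl
  intro z hz
  rw [← Finset.sum_filter]
  have hsub : tgtSets M q G B z ⊆ shadowAt M (q + 2) q (Uq M (q + 2) q) G :=
    fun S hS => (mem_tgtSets.1 hS).1
  rw [Finset.filter_mem_eq_inter, Finset.inter_eq_right.2 hsub]
  exact sum_shareH hG hd hdl (hcond z hz)

open scoped Classical in
/-- The row sum of the distance-one layer for a `P` thin member is its total loss. -/
theorem sum_w2D_row {B : Finset α} (hB : B ∈ thinMembers M q G) (hP : P B)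
    (hrow : ∀ z ∈ G \ clF M B, ∑ S ∈ shadowAt M (q + 2) q (Uq M (q + 2) q) G, dsh B z S = loss M q G B z) :
    ∑ S ∈ shadowAt M (q + 2) q (Uq M (q + 2) q) G, w2D M q G P dsh B S =
      ∑ z ∈ G \ clF M B, loss M q G B z := by
  unfold w2D
  simp only [hB, hP, and_self, if_true]
  rw [Finset.sum_comm]
  apply Finset.sum_congr rfl
  intro z hz
  exact hrow z hz

open scoped Classical in
/-- **Rows are exact**: every member receives exactly its local demand. -/
theorem sum_wHybrid_row (hG : G ∈ flatsQ M (q + 1)) (hd : (gr M \ G).card ≤ q)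
    (hrow : ∀ B ∈ thinMembers M q G, P B → ∀ z ∈ G \ clF M B,
      ∑ S ∈ shadowAt M (q + 2) q (Uq M (q + 2) q) G, dsh B z S = loss M q G B z)
    (hdl : ∀ S ∈ shadowAt M (q + 2) q (Uq M (q + 2) q) G, dload M q G P dsh S ≤ cap2 M q G S)
    (hcond : ∀ B ∈ thinMembers M q G, ¬ P B → ∀ z ∈ G \ clF M B,
      loss M q G B z ≤ rhoL M q G B z * lossIncomeH M q G P dsh B z)
    {B : Finset α} (hB : B ∈ membersIn M (Uq M (q + 2) q) G) :
    ∑ S ∈ shadowAt M (q + 2) q (Uq M (q + 2) q) G, wHybrid M q G P dsh B S =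
      phiQ q * localWeight M B G := by
  have hBU : B ∈ Uq M (q + 2) q := (mem_membersIn.1 hB).1
  have hBG : clF M B ⊆ G := (mem_membersIn.1 hB).2
  have hc : ((gr M \ clF M B).card : ℚ) = ((G \ clF M B).card : ℚ) + ((gr M \ G).card : ℚ) := by
    rw [card_compl_clF_add hG hBG]; push_cast; ring
  unfold wHybrid
  rw [Finset.sum_add_distrib, Finset.sum_add_distrib, Finset.sum_add_distrib]
  by_cases hB0 : B ∈ lay0 M q G
  · rw [sum_w0_row_lay0 hG hB0]
    have hz1 : ∑ S ∈ shadowAt M (q + 2) q (Uq M (q + 2) q) G, w1 M q G B S = 0 := by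
      apply Finset.sum_eq_zero; intro S _
      unfold w1; rw [if_neg]; intro h; exact h.1 hB0
    have hz2 : ∑ S ∈ shadowAt M (q + 2) q (Uq M (q + 2) q) G, w2D M q G P dsh B S = 0 := by
      apply Finset.sum_eq_zero; intro S _
      unfold w2D; rw [if_neg]; intro h; exact (mem_thinMembers.1 h.1).2 hB0
    have hz3 : ∑ S ∈ shadowAt M (q + 2) q (Uq M (q + 2) q) G, w2H M q G P dsh B S = 0 := by
      apply Finset.sum_eq_zero; intro S _
      unfold w2H; rw [if_neg]; intro h; exact (mem_thinMembers.1 h.1).2 hB0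
    rw [hz1, hz2, hz3, add_zero, add_zero, add_zero]
    unfold localWeight
    rw [(mem_lay0.1 hB0).2.1, hc, (mem_lay0.1 hB0).2.1]
    push_cast
    ring
  · have hBt : B ∈ thinMembers M q G := mem_thinMembers.2 ⟨hB, hB0⟩
    have hz0 : ∑ S ∈ shadowAt M (q + 2) q (Uq M (q + 2) q) G, w0 M q G B S = 0 := by
      apply Finset.sum_eq_zero; intro S _
      unfold w0; rw [if_neg]; intro h; exact hB0 h.1
    -- exactly one of the two loss layers carries the losses of `B`
    have hloss : ∑ S ∈ shadowAt M (q + 2) q (Uq M (q + 2) q) G, w2D M q G P dsh B S +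
        ∑ S ∈ shadowAt M (q + 2) q (Uq M (q + 2) q) G, w2H M q G P dsh B S =
        ∑ z ∈ G \ clF M B, loss M q G B z := by
      by_cases hP : P B
      · have hz3 : ∑ S ∈ shadowAt M (q + 2) q (Uq M (q + 2) q) G, w2H M q G P dsh B S = 0 := by
          apply Finset.sum_eq_zero; intro S _
          unfold w2H; rw [if_neg]; intro h; exact h.2 hP
        rw [hz3, add_zero]
        exact sum_w2D_row hBt hP (hrow B hBt hP)
      · have hz2 : ∑ S ∈ shadowAt M (q + 2) q (Uq M (q + 2) q) G, w2D M q G P dsh B S = 0 := by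
          apply Finset.sum_eq_zero; intro S _
          unfold w2D; rw [if_neg]; intro h; exact hP h.2
        rw [hz2, zero_add]
        exact sum_w2H_row hG hd hdl hBt hP (hcond B hBt hP)
    rw [hz0, zero_add, sum_w1_row hG hB hB0, add_assoc, hloss, ← Finset.sum_add_distrib]
    have hterm : ∀ z ∈ G \ clF M B,
        req M q B * fS M q G (insert z B) + loss M q G B z = req M q B := by
      intro z _; unfold loss; ring
    rw [Finset.sum_congr rfl hterm, Finset.sum_const, nsmul_eq_mul]
    unfold req localWeight
    have hcpos : (0 : ℚ) < ((gr M \ clF M B).card : ℚ) := by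
      have := two_le_card_compl_clF hBU
      exact_mod_cast (by omega : 0 < (gr M \ clF M B).card)
    field_simp

/-! ## Columns -/

open scoped Classical in
/-- Every share is at most the weight's share of `S`: `shareH B z S ≤ rhoL B z · cap3 S / pi2MassH S`. -/
theorem shareH_le (hG : G ∈ flatsQ M (q + 1)) (hd : (gr M \ G).card ≤ q)
    (hdl : ∀ S ∈ shadowAt M (q + 2) q (Uq M (q + 2) q) G, dload M q G P dsh S ≤ cap2 M q G S)
    {B : Finset α} {z : α} (hcond : loss M q G B z ≤ rhoL M q G B z * lossIncomeH M q G P dsh B z)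
    {S : Finset α} (hS : S ∈ shadowAt M (q + 2) q (Uq M (q + 2) q) G) :
    shareH M q G P dsh B z S ≤ rhoL M q G B z * (cap3 M q G P dsh S / pi2MassH M q G P S) := by
  unfold shareH
  split_ifs with hl
  · exact mul_nonneg (rhoL_nonneg hG hd B z)
      (div_nonneg (cap3_nonneg (hdl S hS)) (pi2MassH_nonneg hG hd S))
  · have hN : 0 < lossIncomeH M q G P dsh B z := (lossIncomeH_pos hG hd hdl hl hcond).2
    have hq : loss M q G B z / lossIncomeH M q G P dsh B z ≤ rhoL M q G B z := by
      rw [div_le_iff₀ hN]; exact hcond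
    rw [show loss M q G B z * (cap3 M q G P dsh S / pi2MassH M q G P S) / lossIncomeH M q G P dsh B z =
        (loss M q G B z / lossIncomeH M q G P dsh B z) * (cap3 M q G P dsh S / pi2MassH M q G P S) by ring]
    exact mul_le_mul_of_nonneg_right hq
      (div_nonneg (cap3_nonneg (hdl S hS)) (pi2MassH_nonneg hG hd S))

open scoped Classical in
/-- The column sum of the fair-share layer at `S` is at most `cap3 S`. -/
theorem sum_w2H_col_le (hG : G ∈ flatsQ M (q + 1)) (hd : (gr M \ G).card ≤ q)
    (hdl : ∀ S ∈ shadowAt M (q + 2) q (Uq M (q + 2) q) G, dload M q G P dsh S ≤ cap2 M q G S)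
    (hcond : ∀ B ∈ thinMembers M q G, ¬ P B → ∀ z ∈ G \ clF M B,
      loss M q G B z ≤ rhoL M q G B z * lossIncomeH M q G P dsh B z)
    {S : Finset α} (hS : S ∈ shadowAt M (q + 2) q (Uq M (q + 2) q) G) :
    ∑ B ∈ membersIn M (Uq M (q + 2) q) G, w2H M q G P dsh B S ≤ cap3 M q G P dsh S := by
  have hcap : 0 ≤ cap3 M q G P dsh S := cap3_nonneg (hdl S hS)
  have hPi : 0 ≤ pi2MassH M q G P S := pi2MassH_nonneg hG hd S
  have hset : ∑ B ∈ membersIn M (Uq M (q + 2) q) G, w2H M q G P dsh B S =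
      ∑ B ∈ (thinMembers M q G).filter (fun B => ¬ P B),
        ∑ z ∈ G \ clF M B, if S ∈ tgtSets M q G B z then shareH M q G P dsh B z S else 0 := by
    unfold w2H
    rw [← Finset.sum_filter]
    apply Finset.sum_congr
    · ext B
      rw [Finset.mem_filter, Finset.mem_filter, mem_thinMembers]
      tauto
    · intro B _; rfl
  rw [hset]
  calc ∑ B ∈ (thinMembers M q G).filter (fun B => ¬ P B),
        ∑ z ∈ G \ clF M B, (if S ∈ tgtSets M q G B z then shareH M q G P dsh B z S else 0)
      ≤ ∑ B ∈ (thinMembers M q G).filter (fun B => ¬ P B), ∑ z ∈ G \ clF M B,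
          (if S ∈ tgtSets M q G B z then rhoL M q G B z * (cap3 M q G P dsh S / pi2MassH M q G P S) else 0) := by
        apply Finset.sum_le_sum; intro B hB
        rw [Finset.mem_filter] at hB
        apply Finset.sum_le_sum; intro z hz
        split_ifs
        · exact shareH_le hG hd hdl (hcond B hB.1 hB.2 z hz) hS
        · exact le_refl _
    _ = (cap3 M q G P dsh S / pi2MassH M q G P S) * pi2MassH M q G P S := by
        unfold pi2MassH
        rw [Finset.mul_sum]
        apply Finset.sum_congr rfl; intro B _
        rw [Finset.mul_sum]
        apply Finset.sum_congr rfl; intro z _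
        split_ifs <;> ring
    _ ≤ cap3 M q G P dsh S := by
        rcases hPi.lt_or_eq with h | h
        · rw [div_mul_cancel₀ _ h.ne']
        · rw [← h, mul_zero]; exact hcap

open scoped Classical in
/-- The column sum of the distance-one layer at `S` is exactly `dload S`. -/
theorem sum_w2D_col (S : Finset α) :
    ∑ B ∈ membersIn M (Uq M (q + 2) q) G, w2D M q G P dsh B S = dload M q G P dsh S := by
  unfold w2D dload
  rw [← Finset.sum_filter]
  apply Finset.sum_congr
  · ext B
    rw [Finset.mem_filter, Finset.mem_filter, mem_thinMembers]
    tauto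
  · intro B _; rfl

open scoped Classical in
/-- The column sum of the hybrid rule at `S` is at most `1`. -/
theorem sum_wHybrid_col_le (hG : G ∈ flatsQ M (q + 1)) (hd : (gr M \ G).card ≤ q)
    (hdl : ∀ S ∈ shadowAt M (q + 2) q (Uq M (q + 2) q) G, dload M q G P dsh S ≤ cap2 M q G S)
    (hcond : ∀ B ∈ thinMembers M q G, ¬ P B → ∀ z ∈ G \ clF M B,
      loss M q G B z ≤ rhoL M q G B z * lossIncomeH M q G P dsh B z)
    {S : Finset α} (hS : S ∈ shadowAt M (q + 2) q (Uq M (q + 2) q) G) :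
    ∑ B ∈ membersIn M (Uq M (q + 2) q) G, wHybrid M q G P dsh B S ≤ 1 := by
  unfold wHybrid
  rw [Finset.sum_add_distrib, Finset.sum_add_distrib, Finset.sum_add_distrib, sum_w0_col, sum_w1_col, sum_w2D_col]
  have h := sum_w2H_col_le hG hd hdl hcond hS
  unfold cap3 at h
  unfold cap2 capS at h
  have e : (k1 M q G S : ℚ) * (phiQ q / (1 + ((gr M \ G).card : ℚ))) =
      (k1 M q G S : ℚ) * phiQ q / (1 + ((gr M \ G).card : ℚ)) := by ring
  rw [e]
  linarith

/-! ## The certificate -/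

open scoped Classical in
/-- **The local form from the hybrid rule.** With `|E ∖ G| ≤ q`: if the distance-one shares `dsh` of the `P`-members
are nonnegative, supported on the supersets of `B ∪ {z}`, sum to the loss (over the shadow sets) on every `P`-pair and load no
target beyond `cap2`, and every non-`P` loss satisfies `loss B z ≤ rhoL B z · lossIncomeH B z`, then (LI_G) holds. -/
theorem localShadowHall_of_hybrid (hG : G ∈ flatsQ M (q + 1)) (hd : (gr M \ G).card ≤ q)
    (hds : ∀ B z S, 0 ≤ dsh B z S)
    (hsupp : ∀ B z S, dsh B z S ≠ 0 → insert z B ⊆ S)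
    (hrow : ∀ B ∈ thinMembers M q G, P B → ∀ z ∈ G \ clF M B,
      ∑ S ∈ shadowAt M (q + 2) q (Uq M (q + 2) q) G, dsh B z S = loss M q G B z)
    (hdl : ∀ S ∈ shadowAt M (q + 2) q (Uq M (q + 2) q) G, dload M q G P dsh S ≤ cap2 M q G S)
    (hcond : ∀ B ∈ thinMembers M q G, ¬ P B → ∀ z ∈ G \ clF M B,
      loss M q G B z ≤ rhoL M q G B z * lossIncomeH M q G P dsh B z) :
    LocalShadowHall M q G := by
  apply localShadowHall_of_full_matching (wHybrid M q G P dsh)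
  · intro B S
    unfold wHybrid
    exact add_nonneg (add_nonneg (add_nonneg (w0_nonneg q G B S) (w1_nonneg (capS_nonneg' hG hd S) B))
      (w2D_nonneg hds B S)) (w2H_nonneg hG hd hdl B S)
  · exact fun B S h => subset_of_wHybrid_ne hsupp h
  · exact fun S hS => sum_wHybrid_col_le hG hd hdl hcond hS
  · intro B hB
    rw [sum_wHybrid_row hG hd hrow hdl hcond hB]
    exact le_refl _

end HybridRows

end PercRepro.Shadow
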